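import Summits.QuantumFields.YangMills.Theorems.BalabanUVNodesN22AtRecordOfTermDataTableGermsRoad1LocatedRadiiDilatedMembers
import Summits.QuantumFields.YangMills.Theorems.BalabanUVNodesN22W1RelCentredMembersOfDatumOfLocatedRecords

/-!
# BalabanUVNodes ∕ node N22 = NE9 — THE ROAD-1 SOCKET WITH ALL FOUR WINDOW-DILATED MEMBER STATEMENTS READ OFF def-W1's LOCATED RECORDS PER SLICE, BASE POINT AND
# ADMISSIBLE HISTORY (module J81m ∘ module J88-A): `hMdiff`, `hMbd`, the coupling-blind centre `T₀` with its weight `hT₀` AND the centred letter `hMcen` ALL DISCHARGED from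
# ONE `Inputs226Holo` record (W1-8), ONE `LocalGrowthInputs` record (W1-12) and the `UnscaledBoxLaws` — the ROAD-1 twin of module J88

Cell `pub-ymgap`, HUMAN RULING D-0062 (Track A), R134 seat `pub-ymgap-dag-n22-c` (strategy s1: «the history-Lipschitz estimate (2.40)–(2.41) p. 21 of [II] on the W1 object»), generation
21, module J81r.  THEOREMS ONLY (no `def`, no `sorry`, standard axioms); `--kind proof --supports stmt-QuantumFields-27366 --as helper` (K3⁸ `SpineGivenEndpointR13SepCoPHV`), COUNT-NEUTRAL.
Imports this lane's module J81m `…N22AtRecordOfTermDataTableGermsRoad1LocatedRadiiDilatedMembers` (ROAD-1 socket at the members: first-order `hGt` from the members' sector letters, MAX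
clause, NO N18 rate) and module J88-A `…N22W1RelCentredMembersOfDatumOfLocatedRecords` (the four member statements read off the records).  Nothing re-declared; consumed BY NAME.

WHY ∕ WHAT.  Exactly as module J88 (ROAD 2) does for J86, THIS FILE instantiates module J81m with the coupling-blind centre
`T₀ K k Z s old φ := if |P(s)| = 0 then term(A, Γ, F214 |P| 1 1 𝐃 (Y ↦ 𝒪(old,φ;Y,0))) else 0` and `hMdiff ∕ hMbd ∕ hT₀ ∕ hMcen` from module J88-A §1 ∕ §1 ∕ §3 (record at the base point `γ`) ∕ §2,
displaying per slice, base point and admissible history of the bill's generic tables ONE located family `hιc` — `∃ ι : Inputs226Holo c Z s ↑t old φ a a₅, ∃ lg : LocalGrowthInputs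
(χu K k) (𝒲 K k) (𝒪 K k) Z s old φ ι.Uτ, ∃ KE KG′ KCs′ θΓ′ θC′ θE′ a_m w_m δ` with the rows (r1) `K_E` + decay of `C⁻¹`, (r2) primed letters + `θE′, θΓ′ ≤ θ` + the `θ_{R1}` row, (r3) master
rate ∕ width `a_m ≥ (1+ρ_b)²·2ρm₃, 2δ + 8ρm₃`, `w_m ≥ (1+ρ_b)²·ΣR(c₀+c₁ρ)`, `hwc ≤ e^{w_m}`, `δ > 0`, (r4) `hαc ∕ hsmall ∕ hvol` at `(γ₂ + a_m, w_m)`, (r5) ON `|P(s)| = 0` ONLY the box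
block (box law at `t`, rate `0 ≤ κ_b ≤ γ₂ + a_m`, `e^{−½κ_bR_b²} ≤ T·t²`, `1 + T ≤ Mv`), (r6) ON `|P(s)| ≠ 0` ONLY the surplus block (`r₁² ≤ r_P²`, `a ≤ γ₂r₁²`, `e^{−½γ₂(r_P²−r₁²)} ≤ T′·t²`,
`T′ ≤ Mv`) — plus the slice-free box laws `hBox` (W1-12 §2) and `hχ1 : χᵘχᶜᵘ ≤ 1`.
* §1 ★★★ socket `n22At_u3OfRecord₁₃_of_termDataTableGermsLocatedRadiiMembersOfLocatedRecordsRoad1Max` — binder diff vs J81p: `hιm, T₀, hT₀, hMcen` OUT; `hBox, hχ1, hιc` IN.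
THE N22 ROAD-1 BILL AT def-W1's TERM DATA AFTER J81r: (1.21) `hlim`; W1-20's law `hloc`; NODE A's located (2.26) records `hι`, `hloc18`, `hιc`; def-W1's laws (`UnscaledFieldLawOn`, `ReadsBy` +
atom regularity, `MapsToTables … univ` on windows `W ⊇ sp`, `𝒲` measurable, `UnscaledBoxLaws`, `χᵘχᶜᵘ ≤ 1`); chart DATA; numerics (+ apertures, `ρ_b < 1`, `0 ≤ M_v`, `hBqv`, `hlamq`); the
ROAD-1 max clause `ω₁ ≤ μ`, `4M_bc_w∕ϱ ≤ μ`, `μ ≤ ℓ.ω` and the row `hrow`.  NO N18 rate, NO second-order schema.  EVERY N22-side analytic input of the ROAD-1 bill is now a located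
primitive record of NODE A ∕ def-W1 ∕ N09 or a law.

HONEST FRAMING (binding).  Count-neutral INSTANCE of module J81m BY NAME with module J88-A (three applications per slice); `hιc`, the located records, the laws, the chart data,
the numerics and every other binder are DISPLAYED HYPOTHESES (NODE A's ∕ N09's ∕ N10's ∕ N18's standing displayed class; GAPS G-ne9p2-5 ∕ G-t4-U3-1); NO estimate of Bałaban's is
proved or asserted; nothing of the record is constructed or claimed to meet the displayed inputs (A6: `LocalGrowthInputs` ∕ `UnscaledBoxLaws` are consistent by W1-12 §3
`localGrowthInputsZero` ∕ `unscaledBoxLaws_const`; an inhabitant of `Inputs226Holo` at W1-15's free datum is this lane's (t40) — the g8–g10 witnesses J10-W ∕ J12-W ∕ J17-W inhabit the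
Summit-side `SliceInputs*` records carrying the same kernel letters —; a JOINT inhabitant with the numeric rows is NOT exhibited; the ROAD-1 clause needs `ω₁ + c < 1`-type room, J56 §4).  N18, N10 and N22 are NOT discharged (typed 28∕28; count 7∕27 per
dag-lead TABLE — N22 unchanged); K3⁸ OPEN and NOT claimed; NE9 ∕ NE5 NOT IN PRINT for d = 4; no count claim; one finite 𝕋⁴ programme at fixed ε — R4 closes the CONDITIONAL
rung `BalabanLadder.UV` only; NOTHING about the continuum limit, ℝ⁴, infinite volume, OS axioms, a mass gap or the Clay problem is proved or claimed.
References (TYPES only): [II] = Bałaban, CMP 116 (1988) Lemma 2 p. 11, (1.34)–(1.36) p. 9, (1.41) p. 11, (2.2)–(2.3) p. 12, (2.13)–(2.15) pp. 14–15, (2.16)–(2.22) p. 16, (2.23)–(2.26)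
p. 17, Lemma 3 (2.38) p. 20, (2.39)–(2.41) p. 21, (1.26) p. 8; [I] = CMP 109 (1987) §1 p. 263, (1.17)–(1.18) p. 263, (2.8)–(2.13) pp. 266–268; [13] (1.43); Kotecký–Preiss, CMP 103
(1986) Thm p. 492.
-/
noncomputable section

open Set Metric
open scoped BigOperators

namespace YMDAG.N22.KernelFading

open Literature.MathematicalPhysics.QuantumFieldTheory.Balaban1983to89
open Literature.MathematicalPhysics.QuantumFieldTheory.Balaban1983to89.T4Continuum (T4Family ULoop)
open Literature.MathematicalPhysics.QuantumFieldTheory.Balaban1983to89.T4OutputRate (Window NE9)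
open Literature.MathematicalPhysics.QuantumFieldTheory.Balaban1983to89.TreeLengthTorus (TPt TDom tsys torusTreeLen)
open Literature.MathematicalPhysics.QuantumFieldTheory.Balaban1983to89.B9Thm37GlueTorus (tdist1)
open Literature.MathematicalPhysics.QuantumFieldTheory.Balaban1983to89.B12TreeDecay (K₀ kappa₀)
open Literature.MathematicalPhysics.QuantumFieldTheory.Balaban1983to89.B12Decay510 (delta1)
open Literature.MathematicalPhysics.QuantumFieldTheory.Balaban1983to89.B12Decay510Window (K₁)
open Literature.MathematicalPhysics.QuantumFieldTheory.Balaban1983to89.B12Decay510Torus (distCT nearT)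
open Literature.MathematicalPhysics.QuantumFieldTheory.Balaban1983to89.B13Lemma3TorusData (TBond)
open Literature.MathematicalPhysics.QuantumFieldTheory.Balaban1983to89.B13Lemma3TorusTerms (terms weight)
open Literature.MathematicalPhysics.QuantumFieldTheory.Balaban1983to89.B13Lemma3TorusSocket (Lemma3Numerics)
open Literature.MathematicalPhysics.QuantumFieldTheory.Balaban1983to89.B13OlderTermsTableGerms (Pot cv ρ)
open Literature.MathematicalPhysics.QuantumFieldTheory.Balaban1983to89.Node00 (Stage13Params Stage13HParams U3Letters₁₁ MatA)
open Literature.MathematicalPhysics.QuantumFieldTheory.Balaban1983to89.Node00.Sect2 (domSys domCount CPair)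
open Literature.MathematicalPhysics.QuantumFieldTheory.Balaban1983to89.Node00.W1
open Literature.MathematicalPhysics.QuantumFieldTheory.Balaban1983to89.Node00.LocalizedSum17 (ReadingMaps Localizes17OfRecord₁₃)
open Literature.MathematicalPhysics.QuantumFieldTheory.Balaban1983to89.Node00.U3OfKernels (histPrefix objectsOfRecord₁₃)
open Literature.MathematicalPhysics.QuantumFieldTheory.Balaban1983to89.Node00.U3KernelLetters (PolLimitsExistOfRecord₁₃)
open YMDAG.UVSplit (N22At u3OfRecord₁₃ RateReading₁₃CoPH rateCarriersOfRecord₁₃CoPH)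
open YMDAG.N22.AtKernels (n22At_u3OfRecord₁₃_objectsOfRecord₁₃_iff)
open YMDAG.N10 (termReading226_tableGerms_of_inputs226Holo_tauRadii)
open Summit.QuantumFields.YangMills.BalabanUVNodes.N18HLayerW1TermInputs226Chain (recAdmissible_Gn_of_inputs226Holo stepGen_Gn_of_inputs226Holo)
open YMDAG.N18.W1Reading (hLayer_runTowers_toClusterTower_of_stepGen)
open YMDAG.N22.AtRecordOfPrintedSlots (differentiableOn_E_comp_of_printedSlots ball_mem_sp_of_spaceClause)

open YMDAG.N10 (lastCouplingSectors_ofTerms_of_termSectors)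
open YMDAG.N22.TermRecursion (genT1last_of_lastSectorHolo)
open Literature.MathematicalPhysics.QuantumFieldTheory.Balaban1983to89.B13Resummation (locE_congr)

open YMDAG.N22.W1 (isOpen_relSector closedBall_subset_relSector differentiableOn_relSector_of_members norm_le_relSector_of_members
  norm_sub_le_sq_relSector_of_members)

open YMDAG.N22.W1 (radius_pos_of_aperture differentiableOn_and_norm_memberTF_le_weight_of_records norm_memberTF_sub_centre_le_of_records
  norm_centre_le_weight_of_records)
open Literature.MathematicalPhysics.QuantumFieldTheory.Balaban1983to89.B13Term214 (term214 core214 F214)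

open scoped Matrix Matrix.Norms.L2Operator

variable (F : T4Family) (N : ℕ) [NeZero N] {𝔸 : Type} [NormedRing 𝔸] [NormedAlgebra ℂ 𝔸]

/-! ## §1 ★★★ The ROAD-1 kernel-face socket with ALL FOUR member statements READ OFF def-W1's located records per slice, base point and admissible history (J88-A by name) -/

open Classical Finset in
/-- ★★★ **THE ROAD-1 KERNEL-FACE SOCKET WITH THE MEMBER HOLOMORPHY, THE (2.26) WEIGHT, THE COUPLING-BLIND CENTRE AND THE CENTRED LETTER ALL READ OFF def-W1's LOCATED RECORDS** —
module J81m with `T₀ K k Z s old φ := if |P(s)| = 0 then term(A, Γ, F214 |P| 1 1 𝐃 (Y ↦ 𝒪 K k Z s old φ Y 0)) else 0`, `hMdiff ∕ hMbd := (J88-A §1 …).1 ∕ .2`, `hT₀ := J88-A §3` (record at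
the base point `γ`), `hMcen := J88-A §2`, per slice from the located family `hιc` (`ι : (𝔇 K k).Inputs226Holo c Z s ↑t old φ a a₅`, `lg : (𝔇 K k).LocalGrowthInputs (χu K k) (𝒲 K k)
(𝒪 K k) Z s old φ ι.Uτ` + the rows (r1)–(r6)), the box laws `hBox ∕ hχ1`, the unscaled boxes at `t` by `hlaw` (`chiY₀_eq ∕ chicP_eq`) ⟹ **`N22At (u3OfRecord₁₃ θ (objectsOfRecord₁₃ F N θ ℓ) k)`
for EVERY run length `k`** (dag-n27-c's `h22` row; plug = J81p's list with `hιm T₀ hT₀ hMcen ↦ hBox hχ1 hιc`).  LOCATED (hypothesis form); N22 NOT discharged. [folklore] -/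
theorem n22At_u3OfRecord₁₃_of_termDataTableGermsLocatedRadiiMembersOfLocatedRecordsRoad1Max (θ : Stage13Params F N) (ℓ : U3Letters₁₁) (hs : ℓ.Signs) (hγ : 0 < θ.γ) (hlim : PolLimitsExistOfRecord₁₃ F N θ)
    (m' : ℕ) (M : ℕ) [NeZero M] (hM : M = F.L ^ m')
    {c₀ : B13.Consts} {L : ℕ} [NeZero L] (𝔇 : (K : ℕ) → TermData214 c₀ (F.P K) 𝔸 M L) (emb : ReadingMaps F (MatA N) 𝔸)
    (hloc : Localizes17OfRecord₁₃ F N θ (fun K => truncRun K (toClusterTower (𝔇 K).Gn)) emb)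
    (sp : (K j : ℕ) → (domSys (F.P K) M j).Dom → Set (CPair (F.P K) 𝔸))
    (hsp : ∀ (K j : ℕ) (Y : (domSys (F.P K) M j).Dom), IsOpen (sp K j Y))
    {κ δ₀ B₃ r ℓ₁ R E₀ ϱ Mb cw ω₁ μ r₁ cS Bq : ℝ} {aw : ℕ → ℕ → ℕ → ℝ}
    (hκ₀ : kappa₀ (4 * 2 ^ 4) (2 * 4) ≤ κ / 2) (hδ₀ : 0 < δ₀) (hB₃ : 0 ≤ B₃) (hr : 0 < r) (hκE : κ ≤ r₁) (hE₀ : 0 ≤ E₀)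
    (big : (K j : ℕ) → (domSys (F.P K) M j).Dom → Set (CPair (F.P K) 𝔸))
    (hbigo : ∀ (K k : ℕ) (Z : (domSys (F.P K) M (k + 1)).Dom), IsOpen (big K (k + 1) Z))
    (hrestr : ∀ (K k : ℕ), SpRestr (sp K (k + 1))) (hbig : ∀ (K k : ℕ) (Z : (domSys (F.P K) M (k + 1)).Dom), sp K (k + 1) Z ⊆ big K (k + 1) Z)
    (c : B13.Consts) (hL : 8 ≤ c.L) (hLc : c.L = L) (hκ₁ : 1 ≤ c.κ₁) (hα₆ : c.α₆ ≠ 0) {a a₂ a₂' a₅ Aabs : ℝ} (hN : Lemma3Numerics c M ((c.L : ℝ) / 2) a a₂ a₂' a₅ Aabs)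
    {D : ℕ → Set ℂ}
    (hloc18 : ∀ (K k : ℕ), ∀ s ∈ D K, ∀ old : OlderTerms (F.P K) 𝔸 M k,
      (∀ (j : Fin (k + 1)) (Y : (domSys (F.P K) M j).Dom), ∀ ψ ∈ sp K j Y, ‖old j Y ψ‖ ≤ E₀ * Real.exp (-(r₁ * (domSys (F.P K) M j).dj Y))) →
      (∀ (j : Fin (k + 1)) (Y : (domSys (F.P K) M j).Dom), AnalyticOnNhd ℂ (old j Y) (sp K j Y)) →
      ∀ (Z : (domSys (F.P K) M (k + 1)).Dom), ∀ t ∈ terms L M Z, ∀ φ₁ ∈ big K (k + 1) Z, ∃ ι : (𝔇 K k).Inputs226Holo c Z t s old φ₁ a a₅,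
        (∀ φ ∈ big K (k + 1) Z, ∀ i j, DifferentiableOn ℂ (fun σ => (𝔇 K k).A Z t φ σ i j) {σ | ∀ j, σ j ∈ ι.Uσ}) ∧
        (∀ φ ∈ big K (k + 1) Z, ∀ i j, DifferentiableOn ℂ (fun σ => ((𝔇 K k).𝒦 Z t).G2 σ ((𝔇 K k).uOf Z t φ) i j) {σ | ∀ j, σ j ∈ ι.Uσ}) ∧
        (∀ σ : TPt (F.P K).d (domCount (F.P K) M (k + 1)) → ℂ, (∀ j, σ j ∈ ι.Uσ) → ∀ i j, DifferentiableOn ℂ (fun φ => (𝔇 K k).A Z t φ σ i j) (big K (k + 1) Z)) ∧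
        (∀ σ : TPt (F.P K).d (domCount (F.P K) M (k + 1)) → ℂ, (∀ j, σ j ∈ ι.Uσ) →
          ∀ i j, DifferentiableOn ℂ (fun φ => ((𝔇 K k).𝒦 Z t).G2 σ ((𝔇 K k).uOf Z t φ) i j) (big K (k + 1) Z)) ∧
        (∀ Y B, DifferentiableOn ℂ (fun φ => (𝔇 K k).𝒱 Z t s old φ Y B) (big K (k + 1) Z)) ∧
        (∀ φ ∈ big K (k + 1) Z, ∀ Y, Measurable ((𝔇 K k).𝒱 Z t s old φ Y)) ∧
        (∀ φ ∈ big K (k + 1) Z, ∀ σ : TPt (F.P K).d (domCount (F.P K) M (k + 1)) → ℂ, (∀ j, σ j ∈ ι.Uσ) → ((𝔇 K k).A Z t φ σ).IsSymm) ∧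
        (∀ φ ∈ big K (k + 1) Z, ∀ σ : TPt (F.P K).d (domCount (F.P K) M (k + 1)) → ℂ, (∀ j, σ j ∈ ι.Uσ) → (((𝔇 K k).A Z t φ σ).map Complex.re).PosDef) ∧
        (∀ φ ∈ big K (k + 1) Z, ∀ τ : TDom (F.P K).d (L * domCount (F.P K) M (k + 1)) → ℂ, (∀ Y, τ Y ∈ ι.Uτ Y) →
          ∀ B, ∑ Y ∈ t.1, ‖τ Y‖ * ‖(𝔇 K k).𝒱 Z t s old φ Y B‖ ≤ ι.a₂₀ / 2 * (B ⬝ᵥ B) + ι.w) ∧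
        (∀ φ ∈ big K (k + 1) Z, ∀ σ : TPt (F.P K).d (domCount (F.P K) M (k + 1)) → ℂ, (∀ j, σ j ∈ ι.Uσ) → ∀ b j, ‖((𝔇 K k).𝒦 Z t).G2 σ ((𝔇 K k).uOf Z t φ) b j‖ ≤
            ι.KG * Real.exp (-(ι.kap * tdist1 (𝔇 K k).Nf (((𝔇 K k).𝒦 Z t).locΛ b) (((𝔇 K k).𝒦 Z t).locN j)))) ∧
        (∀ φ ∈ big K (k + 1) Z, ∀ σ : TPt (F.P K).d (domCount (F.P K) M (k + 1)) → ℂ, (∀ j, σ j ∈ ι.Uσ) → ∀ b b', ‖((𝔇 K k).A Z t φ σ)⁻¹ b b'‖ ≤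
            ι.KCs * Real.exp (-(ι.kap * tdist1 (𝔇 K k).Nf (((𝔇 K k).𝒦 Z t).locΛ b) (((𝔇 K k).𝒦 Z t).locΛ b')))) ∧
        (∀ φ ∈ big K (k + 1) Z, ∀ σ : TPt (F.P K).d (domCount (F.P K) M (k + 1)) → ℂ, (∀ j, σ j ∈ ι.Uσ) →
          ∀ b j, ‖(((𝔇 K k).𝒦 Z t).G2 σ ((𝔇 K k).uOf Z t φ) - ((𝔇 K k).𝒦 Z t).Γ₀.map (algebraMap ℝ ℂ)) b j‖ ≤
            ι.θΓ * Real.exp (-(ι.kap * tdist1 (𝔇 K k).Nf (((𝔇 K k).𝒦 Z t).locΛ b) (((𝔇 K k).𝒦 Z t).locN j)))) ∧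
        (∀ φ ∈ big K (k + 1) Z, ∀ σ : TPt (F.P K).d (domCount (F.P K) M (k + 1)) → ℂ, (∀ j, σ j ∈ ι.Uσ) →
          ∀ b b', ‖(((𝔇 K k).A Z t φ σ)⁻¹ - ((𝔇 K k).𝒦 Z t).C.map (algebraMap ℝ ℂ)) b b'‖ ≤
            ι.θC * Real.exp (-(ι.kap * tdist1 (𝔇 K k).Nf (((𝔇 K k).𝒦 Z t).locΛ b) (((𝔇 K k).𝒦 Z t).locΛ b')))) ∧
        (∀ φ ∈ big K (k + 1) Z, ∀ σ : TPt (F.P K).d (domCount (F.P K) M (k + 1)) → ℂ, (∀ j, σ j ∈ ι.Uσ) →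
          ∀ b b', ‖((𝔇 K k).A Z t φ σ - ((𝔇 K k).𝒦 Z t).C⁻¹.map (algebraMap ℝ ℂ)) b b'‖ ≤
            ι.θE * Real.exp (-(ι.kap * tdist1 (𝔇 K k).Nf (((𝔇 K k).𝒦 Z t).locΛ b) (((𝔇 K k).𝒦 Z t).locΛ b')))))
    (hD : ∀ K, ∀ t ∈ Ioc (0 : ℝ) θ.γ, ((t : ℝ) : ℂ) ∈ D K)
    {S : ℕ → ℕ → Type} [∀ K k, MeasurableSpace (S K k)] [∀ K k, TopologicalSpace (S K k)] [∀ K k, OpensMeasurableSpace (S K k)]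
    (χu χcu : (K k : ℕ) → (𝔇 K k).UnscaledChi) (𝒲 : (K k : ℕ) → (𝔇 K k).UnscaledWilson) (𝒪 : (K k : ℕ) → (𝔇 K k).UnscaledOlder)
    (Rd : (K k : ℕ) → (Z : (domSys (F.P K) M (k + 1)).Dom) → (t : TermLabel (F.P K) M k L) → (𝔇 K k).ReadingAtoms Z t (S K k))
    (W : (K k : ℕ) → (domSys (F.P K) M (k + 1)).Dom → TermLabel (F.P K) M k L → Set (CPair (F.P K) 𝔸))
    (hlaw : ∀ K, (𝔇 K).UnscaledFieldLawOn (χu K) (χcu K) (𝒲 K) (𝒪 K) θ.γ) (hread : ∀ K k, (𝔇 K k).ReadsBy (𝒪 K k) (Rd K k))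
    (hmaps : ∀ (K k : ℕ) (Z : (domSys (F.P K) M (k + 1)).Dom) (t : TermLabel (F.P K) M k L), (Rd K k Z t).MapsToTables (sp K) (W K k Z t) univ)
    (hW : ∀ (K k : ℕ) (X Z : (domSys (F.P K) M (k + 1)).Dom), Subtype.val Z ⊆ Subtype.val X → ∀ s ∈ terms L M Z, sp K (k + 1) X ⊆ W K k Z s)
    (hcont : ∀ (K k : ℕ) (Z : (domSys (F.P K) M (k + 1)).Dom) (t : TermLabel (F.P K) M k L), (Rd K k Z t).CfgContinuous)
    (hjc : ∀ (K k : ℕ) (Z : (domSys (F.P K) M (k + 1)).Dom) (t : TermLabel (F.P K) M k L), (Rd K k Z t).CfgJointContinuous)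
    {Ck mk : ℝ} (hK : ∀ (K k : ℕ) (Z : (domSys (F.P K) M (k + 1)).Dom) (t : TermLabel (F.P K) M k L), (Rd K k Z t).KernelBounded Ck)
    (hμ : ∀ (K k : ℕ) (Z : (domSys (F.P K) M (k + 1)).Dom) (t : TermLabel (F.P K) M k L), (Rd K k Z t).FiniteMass mk) (hCk : 0 ≤ Ck) (hmk : 0 ≤ mk)
    (hWm : ∀ (K k : ℕ) (Z : (domSys (F.P K) M (k + 1)).Dom) (t : TermLabel (F.P K) M k L) (φ : CPair (F.P K) 𝔸) (Y : TDom (F.P K).d (L * domCount (F.P K) M (k + 1))),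
      Measurable fun B : ((𝔇 K k).𝒦 Z t).Λ → ℝ => 𝒲 K k Z t φ Y B)
    {b : ℝ} (hb : 0 < b) (hbaw : ∀ K k j, b ≤ aw K k j)
    (hι : ∀ (K k : ℕ), ∀ t ∈ Ioc (0 : ℝ) θ.γ, ∀ (X : (domSys (F.P K) M (k + 1)).Dom), ∀ φ ∈ sp K (k + 1) X,
      ∀ Z : (domSys (F.P K) M (k + 1)).Dom, Subtype.val Z ⊆ Subtype.val X → ∀ s ∈ terms L M Z,
        ∃ old₀ ∈ AdmHist (sp K) E₀ r₁ k, ∃ ι : (𝔇 K k).Inputs226Holo c Z s ((t : ℝ) : ℂ) old₀ φ a a₅, ∃ w₀ : ℝ,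
          (∀ τ : TDom (F.P K).d (L * domCount (F.P K) M (k + 1)) → ℂ, (∀ Y, τ Y ∈ ι.Uτ Y) → ∀ B : ((𝔇 K k).𝒦 Z s).Λ → ℝ,
            ∑ Y ∈ s.1, ‖τ Y‖ * ‖(𝔇 K k).𝒱 Z s ((t : ℝ) : ℂ) old₀ φ Y B‖ ≤ ι.a₂₀ / 2 * (B ⬝ᵥ B) + w₀) ∧
          w₀ + (∑ Y ∈ s.1, ((B13Bound143.invTau c ((tsys (F.P K).d (L * domCount (F.P K) M (k + 1))).dj Y))⁻¹ + (𝔇 K k).r + 2)) *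
            ((∑ _j : Fin (k + 1), ∑ _X : (domSys (F.P K) M _j).Dom, Ck) * mk * (E₀ + b⁻¹ * R)) ≤ ι.w)
    (hA0 : 0 ≤ c.C3act * c.ε₁) (hr₁ : 0 ≤ r₁) (hrate : r₁ + 2 * (64 * Real.log 162) + 2 ≤ (1 - 8 * c.δ) * ((c.L : ℝ) / 2) * c.κ)
    (hKP : c.C3act * c.ε₁ * Real.exp (5 * r₁ + 1) * K₀ 64 8 * 9 * 64 < 1) (hrenew : Real.exp 1 * 9 * 64 * K₀ 64 8 ^ 2 * (c.C3act * c.ε₁) ≤ Mb)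
    (hrenewE : Real.exp 1 * 9 * 64 * K₀ 64 8 ^ 2 * (c.C3act * c.ε₁) ≤ E₀)
    (hawcw : ∀ K k j, aw K k j ≤ cw) (hawω : ∀ K k j, j ≤ k → aw K k j ≤ cw * ω₁ ^ (k - j)) (hϱ : 0 < ϱ) (hR : cw * E₀ + ϱ < R)
    {cA ρb Mv : ℝ} (hcS : 0 < cS) (hcSA : cS < cA) (hcA1 : cA < 1) (hρb : cA / (1 - cA) < ρb) (hBq : 0 ≤ Bq)
    (hsmall2 : 2 * (c.C3act * c.ε₁) * Real.exp (5 * r₁ + 1) * K₀ 64 8 * 9 * 64 ≤ 1)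
    (hMv : 0 ≤ Mv)
    (hBqv : 2 * (Real.exp 1 * 9 * 64 * K₀ 64 8 ^ 2 * (2 * (c.C3act * c.ε₁))) * ((1 - cA)⁻¹ ^ 2 * Mv) * (1 + cS) ^ 2 ≤ Bq)
    (hρb1 : ρb < 1)
    -- the laws of the unscaled boxes (W1-12 §2) and `χᵘχᶜᵘ ≤ 1` (products of characteristic functions), slice-free
    (hBox : ∀ (K k : ℕ) (Z : (domSys (F.P K) M (k + 1)).Dom) (s : TermLabel (F.P K) M k L), (𝔇 K k).UnscaledBoxLaws (χu K k) (χcu K k) Z s)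
    (hχ1 : ∀ (K k : ℕ) (Z : (domSys (F.P K) M (k + 1)).Dom) (s : TermLabel (F.P K) M k L) (A : ((𝔇 K k).𝒦 Z s).Λ → ℝ), χu K k Z s A * χcu K k Z s A ≤ 1)
    -- THE LOCATED FAMILY: per slice, base point and admissible history ONE `Inputs226Holo` record, ONE `LocalGrowthInputs` record and the rows (r1)–(r6)
    (hιc : ∀ (K k : ℕ) (old : OlderTerms (F.P K) 𝔸 M k), old ∈ AdmHist (sp K) E₀ r₁ k ∧ old 0 = 0 → ∀ (X : (domSys (F.P K) M (k + 1)).Dom), ∀ φ ∈ sp K (k + 1) X,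
      ∀ Z : (domSys (F.P K) M (k + 1)).Dom, Subtype.val Z ⊆ Subtype.val X → ∀ s ∈ terms L M Z, ∀ t ∈ Ioc (0 : ℝ) θ.γ,
        ∃ ι : (𝔇 K k).Inputs226Holo c Z s ((t : ℝ) : ℂ) old φ a a₅, ∃ lg : (𝔇 K k).LocalGrowthInputs (χu K k) (𝒲 K k) (𝒪 K k) Z s old φ ι.Uτ,
        ∃ KE KG' KCs' θΓ' θC' θE' am wm δ : ℝ,
          0 ≤ KE ∧
          (∀ b b', ‖(((𝔇 K k).𝒦 Z s).C⁻¹.map (algebraMap ℝ ℂ)) b b'‖ ≤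
            KE * Real.exp (-(ι.kap * tdist1 (𝔇 K k).Nf (((𝔇 K k).𝒦 Z s).locΛ b) (((𝔇 K k).𝒦 Z s).locΛ b')))) ∧
          (1 + ρb) * ι.KG ≤ KG' ∧ ((1 - ρb) ^ 2)⁻¹ * ι.KCs ≤ KCs' ∧ ι.θΓ + ρb * ι.KG ≤ θΓ' ∧
          ι.θC + ρb * (2 + ρb) * ((1 - ρb) ^ 2)⁻¹ * ι.KCs ≤ θC' ∧ ι.θE + ρb * (2 + ρb) * (ι.θE + KE) ≤ θE' ∧ θE' ≤ ι.θ ∧ θΓ' ≤ ι.θ ∧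
          ((((𝔇 K k).𝒦 Z s).m * (1 + 2 / (ι.kap - ι.kap')) ^ (𝔇 K k).ν) * (((𝔇 K k).𝒦 Z s).m * (1 + 2 / (ι.kap' - ι.kap'')) ^ (𝔇 K k).ν)
            * (θΓ' * KCs' * KG' + ι.KΓ * θC' * KG' + ι.KΓ * ι.K₀ * θΓ') ≤ ι.θ) ∧
          (1 + ρb) ^ 2 * (2 * lg.ρ * lg.m₃) ≤ am ∧ (1 + ρb) ^ 2 * (∑ Y ∈ s.1, lg.R Y * (lg.c₀ Y + lg.c₁ Y * lg.ρ)) ≤ wm ∧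
          0 < δ ∧ 2 * δ + 8 * lg.ρ * lg.m₃ ≤ am ∧
          Real.exp (∑ Y ∈ s.1, lg.R Y * lg.c₀ Y)
              * ((∑ Y ∈ s.1, lg.R Y * ((4 * lg.c₄ Y + (4 * lg.c₃ Y + 4 * lg.c₃' Y) / lg.ρ) * (4 / (Real.exp 1 * δ)) ^ 4
                    + (lg.c₂ Y + (lg.c₁ Y + lg.c₁' Y) / lg.ρ) * (2 / (Real.exp 1 * δ)) ^ 2)) * Real.exp (δ / 2)
                 + ((∑ Y ∈ s.1, lg.R Y * (4 * lg.c₃ Y * (3 / (Real.exp 1 * δ)) ^ 3 + lg.c₁ Y * (1 / (Real.exp 1 * δ))))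
                      * Real.exp (δ / 2)) ^ 2
                    * Real.exp ((∑ Y ∈ s.1, lg.R Y * (lg.c₀ Y + lg.c₁ Y * lg.ρ)) + ∑ Y ∈ s.1, lg.R Y * lg.c₀ Y))
              ≤ Real.exp wm ∧
          (2 * (ι.θ * (((𝔇 K k).𝒦 Z s).m * (1 + 2 / ι.kap'') ^ (𝔇 K k).ν)) + (ι.γ₂ + am)) * ι.cE ≤ 1 / 2 ∧
          (2 * (ι.θ * (((𝔇 K k).𝒦 Z s).m * (1 + 2 / ι.kap'') ^ (𝔇 K k).ν)) + (ι.γ₂ + am)) * (1 + 2 * ι.cE * ι.g) ≤ 1 / 2 ∧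
          2 * (ι.K₀ * (((𝔇 K k).𝒦 Z s).m * (1 + 2 / ι.kap) ^ (𝔇 K k).ν) * (ι.θ * (((𝔇 K k).𝒦 Z s).m * (1 + 2 / ι.kap'') ^ (𝔇 K k).ν))
              * (1 + (1 - ι.K₀ * (((𝔇 K k).𝒦 Z s).m * (1 + 2 / ι.kap) ^ (𝔇 K k).ν) * (ι.θ * (((𝔇 K k).𝒦 Z s).m * (1 + 2 / ι.kap'') ^ (𝔇 K k).ν)))⁻¹) / 2)
              * (Fintype.card ((𝔇 K k).𝒦 Z s).Λ : ℝ)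
            + wm + (2 * (ι.θ * (((𝔇 K k).𝒦 Z s).m * (1 + 2 / ι.kap'') ^ (𝔇 K k).ν)) + (ι.γ₂ + am)) * ι.cE * (Fintype.card ((𝔇 K k).𝒦 Z s).Λ : ℝ)
            + (2 * (ι.θ * (((𝔇 K k).𝒦 Z s).m * (1 + 2 / ι.kap'') ^ (𝔇 K k).ν)) + (ι.γ₂ + am)) * (1 + 2 * ι.cE * ι.g)
              * (Fintype.card (((𝔇 K k).𝒦 Z s).Λ ⊕ ((𝔇 K k).𝒦 Z s).C₀) : ℝ)
            ≤ a₅ * ((Z.1).card : ℝ) ∧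
          (s.2.card = 0 → ∃ κb Rb T : ℝ, 0 ≤ κb ∧ κb ≤ ι.γ₂ + am ∧
            (∀ B : ((𝔇 K k).𝒦 Z s).Λ → ℝ, B ⬝ᵥ B < Rb ^ 2 → χu K k Z s (t • B) * χcu K k Z s (t • B) = 1) ∧
            Real.exp (-(κb / 2 * Rb ^ 2)) ≤ T * t ^ 2 ∧ 1 + T ≤ Mv) ∧
          (s.2.card ≠ 0 → ∃ r₁' T' : ℝ, r₁' ^ 2 ≤ ι.rP ^ 2 ∧ a ≤ ι.γ₂ * r₁' ^ 2 ∧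
            Real.exp (-(ι.γ₂ / 2 * (ι.rP ^ 2 - r₁' ^ 2))) ≤ T' * t ^ 2 ∧ T' ≤ Mv))
    (hlamq : Bq * θ.γ / cS ≤ ℓ₁) (hℓ₁ : 0 ≤ ℓ₁) (hω₁ : 0 ≤ ω₁)
    (Ec : ℕ → ℕ → Type*) [∀ K k, NormedAddCommGroup (Ec K k)] [∀ K k, NormedSpace ℂ (Ec K k)]
    (ι : letI := θ.instVβ₁; letI := θ.instVβ₂
      (K k : ℕ) → (domSys (F.P K) M (k + 1)).Dom → ((Fin (F.P K).d → Site (F.P K) (k + 1) → θ.Vβ) →L[ℝ] Ec K k))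
    (Φ : (K k : ℕ) → (domSys (F.P K) M (k + 1)).Dom → Ec K k → CPair (F.P K) 𝔸)
    (U : (K k : ℕ) → (domSys (F.P K) M (k + 1)).Dom → Set (Ec K k)) (hU : ∀ K k X, IsOpen (U K k X)) (hrU : ∀ K k X, ball (0 : Ec K k) r ⊆ U K k X)
    (hΦhol : ∀ (K k : ℕ) (X : (domSys (F.P K) M (k + 1)).Dom), DifferentiableOn ℂ (Φ K k X) (U K k X))
    (hΦemb : letI := θ.instVβ₁; letI := θ.instVβ₂
      ∀ (K k : ℕ) (X : (domSys (F.P K) M (k + 1)).Dom) (Bf : Fin (F.P K).d → Site (F.P K) (k + 1) → θ.Vβ),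
        Φ K k X (ι K k X Bf) = emb K k (fun l t => NormedSpace.exp (θ.ρ8 (Bf l t))))
    (hΦsp : ∀ (K k : ℕ) (X : (domSys (F.P K) M (k + 1)).Dom), ∀ z ∈ U K k X, ∀ Z : (domSys (F.P K) M (k + 1)).Dom, Z.1 ⊆ X.1 → Φ K k X z ∈ sp K (k + 1) Z)
    (w : (K k : ℕ) → (domSys (F.P K) M (k + 1)).Dom → Site (F.P K) (k + 1) → ℝ) (hw₀ : ∀ K k X t, 0 ≤ w K k X t)
    (hw : letI := θ.instVβ₁; letI := θ.instVβ₂; letI := θ.instιβ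
      ∀ (K k : ℕ) (X : (domSys (F.P K) M (k + 1)).Dom) (l : Fin (F.P K).d) (t : Site (F.P K) (k + 1)) (c : θ.ιβ),
        ‖ι K k X (Pi.single l (Pi.single t (θ.bV c)))‖ ≤ w K k X t)
    (htail : ∀ (K k : ℕ) (X : (domSys (F.P K) M (k + 1)).Dom) (t : Site (F.P K) (k + 1)),
      let e : Site (F.P K) (k + 1) → TPt 4 (domCount (F.P K) M (k + 1) * M) := fun x i => (ZMod.cast (x i) : ZMod (domCount (F.P K) M (k + 1) * M))
      w K k X t ≤ B₃ * Real.exp (-δ₀ * distCT (domCount (F.P K) M (k + 1)) M (e t) (nearT (M := M) (e t) X)))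
    (hω₁μ : ω₁ ≤ μ) (hCμ : 4 * Mb * cw / ϱ ≤ μ) (hμω : μ ≤ ℓ.ω) (hℓκ : ℓ.κ ≤ delta1 δ₀ κ ((M : ℝ) * 4))
    (hrow : 16 * B₃ ^ 2 / r ^ 2 * Real.exp (delta1 δ₀ κ ((M : ℝ) * 4) * ((M : ℝ) * 4) * 3) * K₀ (4 * 2 ^ 4) (2 * 4) * K₁ 4 (δ₀ / 2) * ℓ₁ ≤ ℓ.C₉ * ℓ.ω) (k : ℕ) :
    N22At (u3OfRecord₁₃ θ (objectsOfRecord₁₃ F N θ ℓ) k) := by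
  have hA6 : 0 ≤ c.α₆ * c.eps2 := mul_nonneg hN.hα₆.le hN.hε₀
  have hρb0 : 0 ≤ ρb := (radius_pos_of_aperture (hcS.trans hcSA) hcA1 hρb).le
  have hγw : θ.γ ∈ Ioc (0 : ℝ) θ.γ := ⟨hγ, le_rfl⟩
  -- per slice and base point: (ι, lg, rows) ⟹ (hMdiff) ∧ (hMbd) by J88-A §1, the unscaled boxes at the base point read off the law
  have hMem : ∀ (K k : ℕ) (old : OlderTerms (F.P K) 𝔸 M k), old ∈ AdmHist (sp K) E₀ r₁ k ∧ old 0 = 0 → ∀ (X : (domSys (F.P K) M (k + 1)).Dom), ∀ φ ∈ sp K (k + 1) X,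
      ∀ Z : (domSys (F.P K) M (k + 1)).Dom, Subtype.val Z ⊆ Subtype.val X → ∀ s ∈ terms L M Z, ∀ t ∈ Ioc (0 : ℝ) θ.γ,
        DifferentiableOn ℂ (fun b => (𝔇 K).memberTF (χu K) (χcu K) (𝒲 K) (𝒪 K) t k Z s b old φ) (ball (1 : ℂ) ρb) ∧
        ∀ b ∈ ball (1 : ℂ) ρb, ‖(𝔇 K).memberTF (χu K) (χcu K) (𝒲 K) (𝒪 K) t k Z s b old φ‖ ≤ weight L M c Z a s * Real.exp (a₅ * ((Z.1).card : ℝ)) := by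
    intro K k old hold X φ hφ Z hZ s hs t ht
    obtain ⟨ι, lg, KE, KG', KCs', θΓ', θC', θE', am, wm, δ, hKE, hCE, hKG', hKCs', hθΓ', hθC', hθE', hθEle, hθΓle, hθR1le, ha', hw', -, -, -, hαc,
      hsmall', hvol, -, -⟩ := hιc K k old hold X φ hφ Z hZ s hs t ht
    exact differentiableOn_and_norm_memberTF_le_weight_of_records (𝔇 K k) (χu K k) (χcu K k) (𝒲 K k) (𝒪 K k) hκ₁ hα₆ Z s old φ ht.1 ι lg (hBox K k Z s)
      ((hlaw K k).chiY₀_eq (𝔇 K k) Z s ht) ((hlaw K k).chicP_eq (𝔇 K k) Z s ht) hρb1 hKE hCE hKG' hKCs' hθΓ' hθC' hθE' hθEle hθΓle hθR1le ha' hw'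
      hαc hsmall' hvol
  refine n22At_u3OfRecord₁₃_of_termDataTableGermsLocatedRadiiDilatedMembersRoad1Max F N
    θ ℓ hs hγ hlim m' M hM 𝔇 emb hloc sp hsp hκ₀ hδ₀ hB₃ hr hκE hE₀ big hbigo hrestr hbig c hL hLc hκ₁ hα₆ hN hloc18 hD χu χcu 𝒲 𝒪 Rd W hlaw hread hmaps hW hcont hjc
    hK hμ hCk hmk hWm hb hbaw hι hA0 hr₁ hrate hKP hrenew hrenewE hawcw hawω hϱ hR hcS hcSA hcA1 hρb hBq hsmall2
    -- the coupling-blind centre (J7a §2 ∕ J8), its `DecidableEq` on the τ-labels pinned to the CLASSICAL instance under which def-W1 ∕ J7a ∕ J8 ∕ J88-A elaborate `term214`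
    -- (this file also sees `B13Carriers.TwoRuns.instDecidableEqTDom` through the N18 chain — README (t34))
    (fun K k Z s old φ => if s.2.card = 0 then
      @term214 ℂ _ _ (TPt (F.P K).d (domCount (F.P K) M (k + 1))) _ (TDom (F.P K).d (L * domCount (F.P K) M (k + 1)))
        (fun a b => Classical.propDecidable (a = b)) (𝔇 K k).r (sigmaList L Z s) (tauList (F.P K) M k L s)
        (core214 ((𝔇 K k).A Z s φ) ((𝔇 K k).Gam Z s φ) (F214 s.2.card (fun _ => (1 : ℝ)) (fun _ => (1 : ℝ)) s.1 (fun Y _ => 𝒪 K k Z s old φ Y 0))) 0 0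
      else 0)
    hMv hBqv
    (fun K k old hold X φ hφ Z hZ s hs t ht => (hMem K k old hold X φ hφ Z hZ s hs t ht).1)
    (fun K k old hold X φ hφ Z hZ s hs t ht => (hMem K k old hold X φ hφ Z hZ s hs t ht).2) ?_ ?_
    hlamq hℓ₁ hω₁ Ec ι Φ U hU hrU hΦhol hΦemb hΦsp w hw₀ hw htail hω₁μ hCμ hμω hℓκ hrow k
  · -- hT₀: the centre's weight, J88-A §3 with the record at the base point γ
    intro K k old hold X φ hφ Z hZ s hs
    obtain ⟨ι, lg, KE, KG', KCs', θΓ', θC', θE', am, wm, δ, -, -, -, -, -, -, -, -, -, -, ha', hw', -, -, -, hαc, hsmall', hvol, -, -⟩ :=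
      hιc K k old hold X φ hφ Z hZ s hs θ.γ hγw
    exact norm_centre_le_weight_of_records (𝔇 K k) (χu K k) (𝒲 K k) (𝒪 K k) hκ₁ hα₆ hA6 Z s old φ ι lg hρb0 ha' hw' hαc hsmall' hvol
  · -- hMcen: the centred letter, J88-A §2
    intro K k old hold X φ hφ Z hZ s hs t ht b hb
    obtain ⟨ι, lg, KE, KG', KCs', θΓ', θC', θE', am, wm, δ, hKE, hCE, hKG', hKCs', hθΓ', hθC', hθE', hθEle, hθΓle, hθR1le, ha', hw', hδ, hac, hwc, hαc,
      hsmall', hvol, hbox0, hsur⟩ := hιc K k old hold X φ hφ Z hZ s hs t ht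
    exact norm_memberTF_sub_centre_le_of_records (𝔇 K k) (χu K k) (χcu K k) (𝒲 K k) (𝒪 K k) hκ₁ hα₆ hA6 Z s old φ ht.1 ι lg (hBox K k Z s) (hχ1 K k Z s)
      ((hlaw K k).chiY₀_eq (𝔇 K k) Z s ht) ((hlaw K k).chicP_eq (𝔇 K k) Z s ht) hρb0 hρb1 hKE hCE hKG' hKCs' hθΓ' hθC' hθE' hθEle hθΓle hθR1le ha' hw'
      hδ hac hwc hαc hsmall' hvol hbox0 hsur b hb

end YMDAG.N22.KernelFading

end
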